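import Literature.MathematicalPhysics.KineticTheory.CollisionTubeDecoratedSumVariance
import HarnessLib

/-!
# The decorated tube sum at fixed positions for a GENERAL bounded mark with a speed cutoff: support, bounded differences,
# and the velocity variance

Topic `Literature/MathematicalPhysics/KineticTheory` (kind proof; companion of `CollisionTubeVarianceStatics.lean`).  That file treats the
truncated even mark `Ξ_L = evenMarkTrunc k l L` of the Enskog closure (crux `JParityClosure.EvenStressEnskog`); the collision-rate FLOOR
at rung 0 (crux `JParityClosure.RateFloor`, stmt-AtomisticToContinuum-13080, line `Sketch`, stub `stub_staticOpacityFloorRung0`) needs the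
same statics for an ARBITRARY measurable mark with `|Ξ| ≤ C` vanishing at relative speed `‖v − v'‖ ≥ 2L` (`L ≥ 0`).  The only properties
of `Ξ_L` used there are exactly these two, so the proofs are copies with `2L ↦ C` in the amplitude:

* `norm_mem_of_tubeMark_ne_zero_of_speedCutoff` — a nonzero tube mark forces `1 < ‖q‖ ≤ 1 + 2Lκ`;
* `abs_tubeMark_le_mul_shellInd` — `|tubeMark κ Ξ (ε⁻¹ sepVec xᵢ xⱼ) vᵢ vⱼ| ≤ C · shellInd`;
* `abs_velAvg_tubeMark_le_of_bound`, `mem_torusShell_of_velAvg_ne_zero_of_speedCutoff` — the velocity-averaged tube mark is bounded by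
  `C` and supported in the torus shell `{ε < ‖reprSym d‖ ≤ ε(1 + 2Lκ)}`;
* `abs_decoratedTubeSum_sub_update_le_of_bound` — one velocity moves `Σ_{i≠j} h(xᵢ) pairTubeMark_{ij}` (`|h| ≤ 1`) by at most
  `4C · shellCount_m`;
* `variance_pi_decoratedTubeSum_le_of_bound` — hence, at fixed non-overlapping positions, `Var ≤ 8 C² (3 + 4Lκ)⁶ (N + 1)` under any
  product velocity law (bounded differences + packing `shellCount_le_cube`).

References: C. Cercignani, R. Illner, M. Pulvirenti (1994) §2.2 [CIPDiluteGases1994]; S. Boucheron, O. Bousquet, G. Lugosi (2004) §2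
[BoucheronBousquetLugosi2004].
-/

noncomputable section

namespace Literature.MathematicalPhysics.KineticTheory

open MeasureTheory ProbabilityTheory Set Filter Function
open scoped ENNReal InnerProductSpace BigOperators
open Literature.Analysis.FluidPDE Literature.Probability.Moments

/-! ## The support of the tube mark of a mark with a speed cutoff -/

/-- **A nonzero tube mark forces `1 < ‖q‖ ≤ 1 + 2Lκ`** for a mark vanishing at relative speed `≥ 2L` (`κ ≥ 0`). [folklore] -/
theorem norm_mem_of_tubeMark_ne_zero_of_speedCutoff {Ξ : V3 × V3 × V3 → ℝ} {L κ : ℝ} (hκ : 0 ≤ κ)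
    (hΞL : ∀ m v v' : V3, 2 * L ≤ ‖v - v'‖ → Ξ (m, v, v') = 0)
    {q v v' : V3} (h : tubeMark κ Ξ q v v' ≠ 0) : 1 < ‖q‖ ∧ ‖q‖ ≤ 1 + 2 * L * κ := by
  obtain ⟨h1, h2⟩ := mem_shell_of_tubeMark_ne_zero h
  have hmem : q ∈ strictTube κ (v - v') := by
    by_contra hn; exact h (by rw [tubeMark, if_neg hn])
  have hΞ : Ξ (impactNormal (v - v') q, v, v') ≠ 0 := fun hz =>
    h (by rw [tubeMark, if_pos hmem, hz])
  have hspeed : ‖v - v'‖ < 2 * L := by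
    by_contra hn; exact hΞ (hΞL _ _ _ (not_lt.1 hn))
  refine ⟨h1, h2.trans ?_⟩
  nlinarith [mul_le_mul_of_nonneg_left hspeed.le hκ]

/-- **A nonzero tube mark puts the pair into the near-contact shell**:
`|tubeMark κ Ξ (ε⁻¹ sepVec xᵢ xⱼ) vᵢ vⱼ| ≤ C · shellInd` for `|Ξ| ≤ C` vanishing at relative speed `≥ 2L`. [folklore] -/
theorem abs_tubeMark_le_mul_shellInd {σ : ℝ} {N : ℕ} (hε : 0 < hsDiameter σ N) {Ξ : V3 × V3 × V3 → ℝ} {C L κ : ℝ}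
    (hC : ∀ p, |Ξ p| ≤ C) (hκ : 0 ≤ κ) (hΞL : ∀ m v v' : V3, 2 * L ≤ ‖v - v'‖ → Ξ (m, v, v') = 0)
    (z : Config (N + 1) (Fin 3) T3) (i j : Fin (N + 1)) :
    |tubeMark κ Ξ ((hsDiameter σ N)⁻¹ • Torus.reprSym ((z i).1 - (z j).1)) (z i).2 (z j).2| ≤ C * shellInd σ N L κ z i j := by
  have hC0 : 0 ≤ C := (abs_nonneg _).trans (hC (0, 0, 0))
  by_cases h0 : tubeMark κ Ξ ((hsDiameter σ N)⁻¹ • Torus.reprSym ((z i).1 - (z j).1)) (z i).2 (z j).2 = 0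
  · rw [h0, abs_zero]
    exact mul_nonneg hC0 (shellInd_nonneg L κ z i j)
  obtain ⟨h1, h2⟩ := norm_mem_of_tubeMark_ne_zero_of_speedCutoff hκ hΞL h0
  have hn : ‖(hsDiameter σ N)⁻¹ • Torus.reprSym ((z i).1 - (z j).1)‖ = (hsDiameter σ N)⁻¹ * ‖sepAt z i j‖ := by
    rw [norm_smul, Real.norm_eq_abs, abs_of_pos (inv_pos.2 hε)]
    rfl
  rw [hn] at h1 h2
  have hs1 : hsDiameter σ N < ‖sepAt z i j‖ := by rwa [lt_inv_mul_iff₀ hε, mul_one] at h1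
  have hs2 : ‖sepAt z i j‖ ≤ hsDiameter σ N * (1 + 2 * L * κ) := by rwa [inv_mul_le_iff₀ hε] at h2
  rw [shellInd, if_pos ⟨hs1, hs2⟩, mul_one]
  exact abs_tubeMark_le hC _ _ _

/-! ## The velocity-averaged tube mark -/

/-- **The velocity-averaged tube mark is bounded by `C`** for `|Ξ| ≤ C` (probability law `γ`). [folklore] -/
theorem abs_velAvg_tubeMark_le_of_bound {Ξ : V3 × V3 × V3 → ℝ} {C : ℝ} (hC : ∀ p, |Ξ p| ≤ C) (ε κ : ℝ) (γ : Measure V3)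
    [IsProbabilityMeasure γ] (d : T3) :
    |∫ p, tubeMark κ Ξ (ε⁻¹ • Torus.reprSym (-d)) p.1 p.2 ∂(γ.prod γ)| ≤ C := by
  have h := norm_integral_le_of_norm_le_const (μ := γ.prod γ)
    (f := fun p : V3 × V3 => tubeMark κ Ξ (ε⁻¹ • Torus.reprSym (-d)) p.1 p.2) (C := C)
    (ae_of_all _ fun p => by rw [Real.norm_eq_abs]; exact abs_tubeMark_le hC _ _ _)
  rwa [probReal_univ, mul_one, Real.norm_eq_abs] at h

/-- **The velocity-averaged tube mark is supported in the torus shell** `{ε < ‖reprSym d‖ ≤ ε(1 + 2Lκ)}` for a mark vanishing at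
relative speed `≥ 2L` (`ε > 0`, `L, κ ≥ 0`). [folklore] -/
theorem mem_torusShell_of_velAvg_ne_zero_of_speedCutoff {Ξ : V3 × V3 × V3 → ℝ} {L κ ε : ℝ} (hκ : 0 ≤ κ)
    (hε : 0 < ε) (hΞL : ∀ m v v' : V3, 2 * L ≤ ‖v - v'‖ → Ξ (m, v, v') = 0) (γ : Measure V3) (d : T3)
    (h : ∫ p, tubeMark κ Ξ (ε⁻¹ • Torus.reprSym (-d)) p.1 p.2 ∂(γ.prod γ) ≠ 0) :
    d ∈ {d : T3 | ε < ‖Torus.reprSym d‖ ∧ ‖Torus.reprSym d‖ ≤ ε * (1 + 2 * L * κ)} := by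
  by_contra hd
  apply h
  refine integral_eq_zero_of_ae (ae_of_all _ fun p => ?_)
  by_contra hne
  obtain ⟨h1, h2⟩ := norm_mem_of_tubeMark_ne_zero_of_speedCutoff hκ hΞL hne
  rw [norm_smul, Real.norm_eq_abs, abs_of_pos (inv_pos.2 hε), norm_reprSym_neg] at h1 h2
  exact hd ⟨by rwa [lt_inv_mul_iff₀ hε, mul_one] at h1, by rwa [inv_mul_le_iff₀ hε] at h2⟩

/-! ## Bounded differences and the velocity variance of the decorated tube sum at fixed positions -/

/-- **One velocity moves the decorated tube sum by at most `4C` times its shell count** (`|Ξ| ≤ C`, speed cutoff `2L`,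
`|h| ≤ 1`; `abs_tubeMark_le_mul_shellInd`). [folklore] -/
theorem abs_decoratedTubeSum_sub_update_le_of_bound {σ : ℝ} (hσ : 0 < σ) {N : ℕ} {Ξ : V3 × V3 × V3 → ℝ} {C L κ : ℝ}
    (hC : ∀ p, |Ξ p| ≤ C) (hκ : 0 ≤ κ) (hΞL : ∀ m v v' : V3, 2 * L ≤ ‖v - v'‖ → Ξ (m, v, v') = 0)
    {h : T3 → ℝ} (hh1 : ∀ y, |h y| ≤ 1) (x : Fin (N + 1) → T3) (v : Fin (N + 1) → V3) (m : Fin (N + 1)) (y : V3) :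
    |(∑ i, ∑ j, if i ≠ j then h (x i) * pairTubeMark (hsDiameter σ N) κ Ξ i j x v else 0) -
      (∑ i, ∑ j, if i ≠ j then h (x i) * pairTubeMark (hsDiameter σ N) κ Ξ i j x (update v m y) else 0)| ≤
      4 * C * shellCount σ N L κ (zipConfig (x, v)) m := by
  have hε := hsDiameter_pos hσ N
  have hC0 : 0 ≤ C := (abs_nonneg _).trans (hC (0, 0, 0))
  set v' := update v m y with hv'
  set M : (Fin (N + 1) → V3) → Fin (N + 1) → Fin (N + 1) → ℝ :=
    fun w a b => pairTubeMark (hsDiameter σ N) κ Ξ a b x w with hM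
  set shI : Fin (N + 1) → Fin (N + 1) → ℝ := fun a b => shellInd σ N L κ (zipConfig (x, v)) a b with hshI
  have hshI0 : ∀ a b, 0 ≤ shI a b := fun a b => shellInd_nonneg L κ _ a b
  have hMle : ∀ w a b, |M w a b| ≤ C * shI a b := fun w a b => by
    have h0 := abs_tubeMark_le_mul_shellInd hε hC hκ hΞL (zipConfig (x, w)) a b
    rw [shellInd_zipConfig_eq L κ x w v a b] at h0
    exact h0
  set T : (Fin (N + 1) → V3) → Fin (N + 1) → Fin (N + 1) → ℝ :=
    fun w a b => if a ≠ b then h (x a) * M w a b else 0 with hT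
  have hTle : ∀ w a b, |T w a b| ≤ C * shI a b := fun w a b => by
    simp only [hT]
    split_ifs
    · rw [abs_mul]
      exact (mul_le_mul (hh1 _) (hMle w a b) (abs_nonneg _) zero_le_one).trans_eq (one_mul _)
    · rw [abs_zero]; exact mul_nonneg hC0 (hshI0 a b)
  have hdiff : ∀ a b, |T v a b - T v' a b| ≤
      2 * C * shI a b * ((if a = m then (1 : ℝ) else 0) + (if b = m then (1 : ℝ) else 0)) := by
    intro a b
    by_cases hab : a = m ∨ b = m
    · have h1 : (1 : ℝ) ≤ (if a = m then (1 : ℝ) else 0) + (if b = m then (1 : ℝ) else 0) := by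
        rcases hab with ha | hb
        · rw [if_pos ha]; split_ifs <;> norm_num
        · rw [if_pos hb]; split_ifs <;> norm_num
      have h2 : |T v a b - T v' a b| ≤ 2 * C * shI a b := by
        calc |T v a b - T v' a b| ≤ |T v a b| + |T v' a b| := abs_sub _ _
          _ ≤ C * shI a b + C * shI a b := add_le_add (hTle v a b) (hTle v' a b)
          _ = 2 * C * shI a b := by ring
      calc |T v a b - T v' a b| ≤ 2 * C * shI a b * 1 := by rw [mul_one]; exact h2
        _ ≤ _ := mul_le_mul_of_nonneg_left h1 (mul_nonneg (by positivity) (hshI0 a b))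
    · push Not at hab
      have hsame : T v a b = T v' a b := by
        simp only [hT, hM, pairTubeMark, hv', update_of_ne hab.1, update_of_ne hab.2]
      rw [hsame, sub_self, abs_zero]
      refine mul_nonneg (mul_nonneg (by positivity) (hshI0 a b)) (add_nonneg ?_ ?_) <;> split_ifs <;> norm_num
  have hsum : ∑ a, ∑ b, 2 * C * shI a b * ((if a = m then (1 : ℝ) else 0) + (if b = m then (1 : ℝ) else 0)) =
      4 * C * shellCount σ N L κ (zipConfig (x, v)) m := by
    have e1 : ∀ a b : Fin (N + 1), 2 * C * shI a b * ((if a = m then (1 : ℝ) else 0) + (if b = m then (1 : ℝ) else 0)) =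
        (if a = m then 2 * C * shI a b else 0) + (if b = m then 2 * C * shI a b else 0) := fun a b => by
      split_ifs <;> ring
    simp_rw [e1, Finset.sum_add_distrib]
    have e2 : ∑ a : Fin (N + 1), ∑ b : Fin (N + 1), (if a = m then 2 * C * shI a b else 0) = 2 * C * ∑ b, shI m b := by
      have : ∀ a : Fin (N + 1), ∑ b : Fin (N + 1), (if a = m then 2 * C * shI a b else 0) =
          if a = m then 2 * C * ∑ b, shI a b else 0 := fun a => by
        split_ifs
        · rw [Finset.mul_sum]
        · simp
      simp_rw [this]
      rw [Finset.sum_ite_eq' Finset.univ m, if_pos (Finset.mem_univ _)]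
    have e3 : ∑ a : Fin (N + 1), ∑ b : Fin (N + 1), (if b = m then 2 * C * shI a b else 0) = 2 * C * ∑ a, shI a m := by
      rw [Finset.mul_sum]
      refine Finset.sum_congr rfl fun a _ => ?_
      rw [Finset.sum_ite_eq' Finset.univ m, if_pos (Finset.mem_univ _)]
    have e4 : ∑ a : Fin (N + 1), shI a m = ∑ b, shI m b :=
      Finset.sum_congr rfl fun a _ => shellInd_comm L κ _ a m
    rw [e2, e3, e4, shellCount]
    ring
  have e : (∑ i, ∑ j, if i ≠ j then h (x i) * pairTubeMark (hsDiameter σ N) κ Ξ i j x v else 0) -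
      (∑ i, ∑ j, if i ≠ j then h (x i) * pairTubeMark (hsDiameter σ N) κ Ξ i j x v' else 0) =
      ∑ a, ∑ b, (T v a b - T v' a b) := by
    simp only [hT, hM, Finset.sum_sub_distrib]
  rw [e, ← hsum]
  exact (Finset.abs_sum_le_sum_abs _ _).trans (Finset.sum_le_sum fun a _ =>
    (Finset.abs_sum_le_sum_abs _ _).trans (Finset.sum_le_sum fun b _ => hdiff a b))

/-- **The velocity variance of the decorated tube sum at fixed non-overlapping positions** is at most
`8 C² (3 + 4Lκ)⁶ (N + 1)` under any product law `γ^{⊗(N+1)}` of the velocities (`γ` a probability measure; `Ξ` measurable with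
`|Ξ| ≤ C` and speed cutoff `2L`, `|h| ≤ 1`): bounded differences `c_m = 4C · shellCount_m ≤ 4C (3 + 4Lκ)³` in `Var ≤ ½ Σ_m c_m²`.
[folklore] -/
theorem variance_pi_decoratedTubeSum_le_of_bound {σ : ℝ} (hσ : 0 < σ) {N : ℕ} {Ξ : V3 × V3 × V3 → ℝ} (hΞm : Measurable Ξ)
    {C L κ : ℝ} (hC : ∀ p, |Ξ p| ≤ C) (hL : 0 ≤ L) (hκ : 0 ≤ κ) (hΞL : ∀ m v v' : V3, 2 * L ≤ ‖v - v'‖ → Ξ (m, v, v') = 0)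
    {h : T3 → ℝ} (hh1 : ∀ y, |h y| ≤ 1) (γ : Measure V3) [IsProbabilityMeasure γ]
    {x : Fin (N + 1) → T3} (hx : x ∈ posDomain (hsDiameter σ N) (N + 1)) :
    variance (fun v => ∑ i, ∑ j, if i ≠ j then h (x i) * pairTubeMark (hsDiameter σ N) κ Ξ i j x v else 0)
      (Measure.pi fun _ : Fin (N + 1) => γ) ≤ 8 * C ^ 2 * (3 + 4 * L * κ) ^ 6 * (N + 1 : ℕ) := by
  have hε := hsDiameter_pos hσ N
  have hC0 : 0 ≤ C := (abs_nonneg _).trans (hC (0, 0, 0))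
  set g : (Fin (N + 1) → V3) → ℝ := fun v => ∑ i, ∑ j, if i ≠ j then
    h (x i) * pairTubeMark (hsDiameter σ N) κ Ξ i j x v else 0 with hg
  have hgm : Measurable g := Finset.measurable_sum _ fun i _ => Finset.measurable_sum _ fun j _ =>
    measurable_decoratedTubeTerm _ κ hΞm h x i j
  have hterm : ∀ v i j, |(if i ≠ j then h (x i) * pairTubeMark (hsDiameter σ N) κ Ξ i j x v else 0)| ≤ C := fun v i j => by
    split_ifs
    · rw [abs_mul]
      exact (mul_le_mul (hh1 _) (abs_pairTubeMark_le _ κ hC i j x v) (abs_nonneg _) zero_le_one).trans_eq (one_mul _)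
    · rw [abs_zero]; exact hC0
  have hgb : ∀ v, |g v| ≤ (N + 1 : ℕ) * ((N + 1 : ℕ) * C) := fun v => by
    refine (Finset.abs_sum_le_sum_abs _ _).trans ?_
    calc ∑ i, |∑ j, (if i ≠ j then h (x i) * pairTubeMark (hsDiameter σ N) κ Ξ i j x v else 0)|
        ≤ ∑ _i : Fin (N + 1), ((N + 1 : ℕ) * C) := Finset.sum_le_sum fun i _ =>
          (Finset.abs_sum_le_sum_abs _ _).trans ((Finset.sum_le_sum fun j _ => hterm v i j).trans (by
            rw [Finset.sum_const, Finset.card_univ, Fintype.card_fin, nsmul_eq_mul]))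
      _ = (N + 1 : ℕ) * ((N + 1 : ℕ) * C) := by
          rw [Finset.sum_const, Finset.card_univ, Fintype.card_fin, nsmul_eq_mul]
  set c : Fin (N + 1) → ℝ := fun m => 4 * C * shellCount σ N L κ (zipConfig (x, fun _ => (0 : V3))) m with hc
  have hdiff : ∀ m v y, |g v - g (update v m y)| ≤ c m := fun m v y => by
    have h0 := abs_decoratedTubeSum_sub_update_le_of_bound hσ hC hκ hΞL hh1 x v m y
    have hsc : shellCount σ N L κ (zipConfig (x, v)) m = shellCount σ N L κ (zipConfig (x, fun _ => (0 : V3))) m := rfl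
    rw [hsc] at h0
    exact h0
  have hvar := variance_le_of_bounded_differences (fun _ : Fin (N + 1) => γ) hgm hgb hdiff
  have hCm : ∀ m, c m ^ 2 ≤ (4 * C * (3 + 4 * L * κ) ^ 3) ^ 2 := fun m => by
    have h1 : 0 ≤ c m := mul_nonneg (by positivity) (Finset.sum_nonneg fun b _ => shellInd_nonneg L κ _ m b)
    have h2 : c m ≤ 4 * C * (3 + 4 * L * κ) ^ 3 :=
      mul_le_mul_of_nonneg_left (shellCount_zipConfig_le_cube hε (mul_nonneg hL hκ) hx _ m) (by positivity)
    exact pow_le_pow_left₀ h1 h2 2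
  calc variance g (Measure.pi fun _ : Fin (N + 1) => γ) ≤ (1 / 2 : ℝ) * ∑ m, c m ^ 2 := hvar
    _ ≤ (1 / 2 : ℝ) * ∑ _m : Fin (N + 1), (4 * C * (3 + 4 * L * κ) ^ 3) ^ 2 :=
        mul_le_mul_of_nonneg_left (Finset.sum_le_sum fun m _ => hCm m) (by norm_num)
    _ = 8 * C ^ 2 * (3 + 4 * L * κ) ^ 6 * (N + 1 : ℕ) := by
        rw [Finset.sum_const, Finset.card_univ, Fintype.card_fin, nsmul_eq_mul]; ring

/-! ## The variance of the decorated tube sum on the product space, modulo the decorated pair-pair decorrelation -/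

/-- **Variance of the decorated tube sum under `P_N ⊗ γ^{⊗(N+1)}` for a general bounded mark with a speed cutoff** (small density,
`N ≥ 1`, measurable `Ξ` with `|Ξ| ≤ C`, `0 < C`, vanishing at relative speed `≥ 2L`, `0 ≤ L`, `0 ≤ κ`, `ε(1 + 2Lκ) < 1/2`, `|h| ≤ 1`
measurable, probability law `γ`), GIVEN the decorated pair-pair decorrelation bound at level `ζ` (the hypothesis Plateau′ of the rung-0
closures of `JParityClosure.EvenStressEnskog` / `RateFloor`): with `v = (4π/3)(ε(1 + 2Lκ))³`,
`Var(S) ≤ 16 C² (3 + 4Lκ)⁶ (N+1) + 2 (N+1)² (16 C² v + 96 (N+1) C² v² + 4 ζ (N+1)² C² v²)`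
(law of total variance, `variance_pi_decoratedTubeSum_le_of_bound`, `variance_decoratedPairSum_le`; copy of
`variance_prod_decoratedTubeSum_le` with `2L ↦ C`). [folklore] -/
theorem variance_prod_decoratedTubeSum_le_of_bound {σ : ℝ} (hsd : SmallDensity uniformProfile σ) {N : ℕ} (hN : 1 ≤ N)
    {Ξ : V3 × V3 × V3 → ℝ} (hΞm : Measurable Ξ) {C L κ : ℝ} (hCpos : 0 < C) (hC : ∀ p, |Ξ p| ≤ C) (hL : 0 ≤ L) (hκ : 0 ≤ κ)
    (hΞL : ∀ m v v' : V3, 2 * L ≤ ‖v - v'‖ → Ξ (m, v, v') = 0) (hεL : hsDiameter σ N * (1 + 2 * L * κ) < 1 / 2)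
    {h : T3 → ℝ} (hh : Measurable h) (hh1 : ∀ y, |h y| ≤ 1) (γ : Measure V3) [IsProbabilityMeasure γ]
    {ζ : ℝ} (hζ : 0 ≤ ζ)
    (hdec : ∀ i j i' j' : Fin (N + 1), i ≠ j → i ≠ i' → i ≠ j' → j ≠ i' → j ≠ j' → i' ≠ j' →
      ∀ T T' : Set T3, MeasurableSet T → MeasurableSet T' →
      |(∫ x, h (x i) * T.indicator (fun _ => (1 : ℝ)) (x j - x i) * (h (x i') * T'.indicator (fun _ => (1 : ℝ)) (x j' - x i'))
          ∂posGibbsMeasure (fun _ : T3 => (1 : ℝ)) (hsDiameter σ N) (N + 1)) -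
        (∫ x, h (x i) * T.indicator (fun _ => (1 : ℝ)) (x j - x i) ∂posGibbsMeasure (fun _ : T3 => (1 : ℝ)) (hsDiameter σ N) (N + 1)) *
        (∫ x, h (x i') * T'.indicator (fun _ => (1 : ℝ)) (x j' - x i') ∂posGibbsMeasure (fun _ : T3 => (1 : ℝ)) (hsDiameter σ N) (N + 1))|
        ≤ ζ * (volume T).toReal * (volume T').toReal) :
    variance (fun p : (Fin (N + 1) → T3) × (Fin (N + 1) → V3) =>
        ∑ i, ∑ j, if i ≠ j then h (p.1 i) * pairTubeMark (hsDiameter σ N) κ Ξ i j p.1 p.2 else 0)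
      ((posGibbsMeasure (fun _ : T3 => (1 : ℝ)) (hsDiameter σ N) (N + 1)).prod (Measure.pi fun _ : Fin (N + 1) => γ)) ≤
      16 * C ^ 2 * (3 + 4 * L * κ) ^ 6 * (N + 1 : ℕ) +
        2 * (((N + 1 : ℕ) : ℝ) ^ 2 * (16 * C ^ 2 * (4 / 3 * Real.pi * (hsDiameter σ N * (1 + 2 * L * κ)) ^ 3) +
          96 * ((N + 1 : ℕ) : ℝ) * C ^ 2 * (4 / 3 * Real.pi * (hsDiameter σ N * (1 + 2 * L * κ)) ^ 3) ^ 2 +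
          4 * ζ * ((N + 1 : ℕ) : ℝ) ^ 2 * C ^ 2 * (4 / 3 * Real.pi * (hsDiameter σ N * (1 + 2 * L * κ)) ^ 3) ^ 2)) := by
  have hσ := hsd.σ_pos
  have hε := hsDiameter_pos hσ N
  haveI := isProbabilityMeasure_posGibbsMeasure continuous_const (fun _ => one_pos) hsd.σ_lt_half.le N
  set P := posGibbsMeasure (fun _ : T3 => (1 : ℝ)) (hsDiameter σ N) (N + 1) with hP
  set Q : Measure (Fin (N + 1) → V3) := Measure.pi fun _ : Fin (N + 1) => γ with hQ
  set ε := hsDiameter σ N with hεdef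
  set S : (Fin (N + 1) → T3) × (Fin (N + 1) → V3) → ℝ := fun p =>
    ∑ i, ∑ j, if i ≠ j then h (p.1 i) * pairTubeMark ε κ Ξ i j p.1 p.2 else 0 with hS
  have hSm : Measurable S := measurable_decoratedTubeSum ε κ hΞm hh
  have hC0 : 0 ≤ C := hCpos.le
  have hterm : ∀ (p : (Fin (N + 1) → T3) × (Fin (N + 1) → V3)) i j,
      |(if i ≠ j then h (p.1 i) * pairTubeMark ε κ Ξ i j p.1 p.2 else 0)| ≤ C := fun p i j => by
    split_ifs
    · rw [abs_mul]
      exact (mul_le_mul (hh1 _) (abs_pairTubeMark_le _ κ hC i j p.1 p.2) (abs_nonneg _) zero_le_one).trans_eq (one_mul _)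
    · rw [abs_zero]; exact hC0
  have hSb : ∀ p, |S p| ≤ (N + 1 : ℕ) * ((N + 1 : ℕ) * C) := fun p => by
    refine (Finset.abs_sum_le_sum_abs _ _).trans ?_
    calc ∑ i, |∑ j, (if i ≠ j then h (p.1 i) * pairTubeMark ε κ Ξ i j p.1 p.2 else 0)|
        ≤ ∑ _i : Fin (N + 1), ((N + 1 : ℕ) * C) := Finset.sum_le_sum fun i _ =>
          (Finset.abs_sum_le_sum_abs _ _).trans ((Finset.sum_le_sum fun j _ => hterm p i j).trans (by
            rw [Finset.sum_const, Finset.card_univ, Fintype.card_fin, nsmul_eq_mul]))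
      _ = (N + 1 : ℕ) * ((N + 1 : ℕ) * C) := by
          rw [Finset.sum_const, Finset.card_univ, Fintype.card_fin, nsmul_eq_mul]
  -- law of total variance
  have hsplit := variance_prod_le P Q hSm hSb
  -- (i) the velocity variance at fixed positions, a.s. on the hard core
  have h1 : ∫ x, variance (fun v => S (x, v)) Q ∂P ≤ 8 * C ^ 2 * (3 + 4 * L * κ) ^ 6 * (N + 1 : ℕ) := by
    have hae : ∀ᵐ x ∂P, variance (fun v => S (x, v)) Q ≤ 8 * C ^ 2 * (3 + 4 * L * κ) ^ 6 * (N + 1 : ℕ) := by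
      filter_upwards [ae_mem_posDomain (fun _ : T3 => (1 : ℝ)) ε (N + 1)] with x hx
      exact variance_pi_decoratedTubeSum_le_of_bound hσ hΞm hC hL hκ hΞL hh1 γ hx
    calc ∫ x, variance (fun v => S (x, v)) Q ∂P ≤ ∫ _x, 8 * C ^ 2 * (3 + 4 * L * κ) ^ 6 * (N + 1 : ℕ) ∂P :=
          integral_mono_of_nonneg (ae_of_all _ fun x => variance_nonneg _ _) (integrable_const _) hae
      _ = 8 * C ^ 2 * (3 + 4 * L * κ) ^ 6 * (N + 1 : ℕ) := by rw [integral_const, probReal_univ, one_smul]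
  -- (ii) the conditional mean is the decorated pair sum with the velocity-averaged tube mark
  set φ : T3 → ℝ := fun d => ∫ p, tubeMark κ Ξ (ε⁻¹ • Torus.reprSym (-d)) p.1 p.2 ∂(γ.prod γ) with hφ
  have hmean : (fun x => ∫ v, S (x, v) ∂Q) = fun x => ∑ i, ∑ j, if i ≠ j then h (x i) * φ (x j - x i) else 0 := by
    funext x
    exact integral_pi_decoratedTubeSum ε κ hΞm hC h γ x
  set D : Set T3 := {d : T3 | ε < ‖Torus.reprSym d‖ ∧ ‖Torus.reprSym d‖ ≤ ε * (1 + 2 * L * κ)} with hD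
  have hφm : Measurable φ := measurable_velAvg_tubeMark ε κ hΞm γ
  have hφB : ∀ d, |φ d| ≤ C := fun d => abs_velAvg_tubeMark_le_of_bound hC ε κ γ d
  have hφD : ∀ d, φ d ≠ 0 → d ∈ D := fun d hd => mem_torusShell_of_velAvg_ne_zero_of_speedCutoff hκ hε hΞL γ d hd
  have hDm : MeasurableSet D := measurableSet_torusShell ε _
  have hDs : ∀ d, d ∈ D ↔ -d ∈ D := fun d => mem_torusShell_iff_neg_mem ε _ d
  have h2 := variance_decoratedPairSum_le hsd hN hh hh1 hφm hCpos hφB hDm hDs hφD hζ hdec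
  -- the shell volume
  have hv : (volume D).toReal ≤ 4 / 3 * Real.pi * (ε * (1 + 2 * L * κ)) ^ 3 :=
    volume_real_torusShell_le ε (mul_nonneg hε.le (by nlinarith)) hεL
  have hv0 : 0 ≤ (volume D).toReal := ENNReal.toReal_nonneg
  have h2' : variance (fun x => ∫ v, S (x, v) ∂Q) P ≤
      ((N + 1 : ℕ) : ℝ) ^ 2 * (16 * C ^ 2 * (4 / 3 * Real.pi * (ε * (1 + 2 * L * κ)) ^ 3) +
        96 * ((N + 1 : ℕ) : ℝ) * C ^ 2 * (4 / 3 * Real.pi * (ε * (1 + 2 * L * κ)) ^ 3) ^ 2 +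
        4 * ζ * ((N + 1 : ℕ) : ℝ) ^ 2 * C ^ 2 * (4 / 3 * Real.pi * (ε * (1 + 2 * L * κ)) ^ 3) ^ 2) := by
    rw [hmean]
    refine h2.trans ?_
    have hv2 : (volume D).toReal ^ 2 ≤ (4 / 3 * Real.pi * (ε * (1 + 2 * L * κ)) ^ 3) ^ 2 :=
      pow_le_pow_left₀ hv0 hv 2
    have hn : (0 : ℝ) ≤ ((N + 1 : ℕ) : ℝ) := by positivity
    gcongr
  linarith [hsplit, h1, h2']

end Literature.MathematicalPhysics.KineticTheory

end
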